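import Mathlib
import Summits.KontsevichZagierPeriods.KontsevichZagierPeriods.Theses.HyperbolicBloch
import Literature.NumberTheory.Transcendental.ZagierDilogarithmConjecture
import Literature.NumberTheory.Transcendental.BlochWignerDilogarithm
import Literature.NumberTheory.Transcendental.BlochWignerDilogarithmVolumeProofs
import Literature.NumberTheory.Transcendental.BlochWignerFiveTerm
import Literature.NumberTheory.Transcendental.PreBlochGroup
import Literature.ModelTheory.ExponentialFields.Semialgebraic
import Literature.ModelTheory.ExponentialFields.WilkieConjecture
import Literature.ModelTheory.ExponentialFields.RealAnExp
import Literature.ModelTheory.ExponentialFields.PilaWilkieCounting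
import Literature.ModelTheory.ExponentialFields.RealAnExpCounting

/-!
# Sketch (crux-ideate, round 1, ideator 1) — crux `ZagierDilogarithmConjecture`
# (stmt-KontsevichZagierPeriods-10550, route HyperbolicBloch)

First lemmas of the two idea cards, typed over existing declarations:

* §0  the crux is verbatim `Literature…ZagierDilogarithmRelationsConjecture` (both directions, proved);
* §A  card `level-set-counting` (o-minimal counting + real-arc Ax–Lindemann for `D`):
      `levelSet`, `DefinableBlochWignerGraph`/`DefinableLevelSets`, `NoFlatArcs`, `RealArcAxLindemannTwo`,
      the PROVED corollary `levelSet_ratPoints_sparse` (Pila–Wilkie in `ℝ_an,exp`, tree facts), and the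
      PROVED o-minimal dichotomy `zagierTwoTerm_iff_parts` / `algPart_clause_of` / `zagierTwoTerm_of`
      isolating the open core `TransPartExplainedTwo`;
* §B  card `kummer-clausen-linearisation` (transfer to the unit circle = Clausen/linear form):
      `kummer_mem_closure` (PROVED: one five-term instance + three symmetric relators),
      `ClausenForm`, `TwoSaturation`, `clausenForm_of` (trivial direction, proved),
      the transfer `ZagierOfClausenForm` (stub) and `crux_of_clausenForm` (proved modulo the Props).
Ideator 1 = planner-cruxidea-stmt-KontsevichZagierPeriods-10550-1-0, 2026-08-16.
-/

noncomputable section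

open scoped BigOperators ComplexConjugate
open Set FirstOrder
open Literature.NumberTheory.Transcendental
open Literature.ModelTheory.ExponentialFields

namespace Summit.KontsevichZagierPeriods.KontsevichZagierPeriods.Cruxes.ZagierDilogarithmConjecture.Ideator1

/-! ## §0 The crux is the Literature conjecture -/

/-- The route decl is verbatim the inline form of the named open conjecture. [folklore] -/
theorem crux_iff :
    Theses.HyperbolicBloch.ZagierDilogarithmConjecture ↔ ZagierDilogarithmRelationsConjecture := by
  constructor
  · intro h
    exact ZagierDilogarithmRelationsConjecture.of_inline idealTetrahedron (fun z => rfl)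
      (h idealTetrahedron (fun z => rfl))
  · intro h T hT
    exact h.inline T hT

/-! ## §A Level sets of `Σ nᵢ D(zᵢ)` as definable sets; counting; real-arc Ax–Lindemann -/

/-- Realification: a point of `ℝ^{k + k}` read as `k` complex numbers (re-parts on the first
block, im-parts on the second). -/
def toC (k : ℕ) (v : Fin (k + k) → ℝ) (i : Fin k) : ℂ := ⟨v (Fin.castAdd k i), v (Fin.natAdd k i)⟩

/-- The level set `Z_n = {z ∈ (ℍ⁺)^k : Σ nᵢ D(zᵢ) = 0}` inside `ℝ^{2k}`. -/
def levelSet (k : ℕ) (n : Fin k → ℤ) : Set (Fin (k + k) → ℝ) :=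
  {v | (∀ i : Fin k, 0 < v (Fin.natAdd k i)) ∧ ∑ i, (n i : ℝ) * blochWignerDilog (toC k v i) = 0}

/-- (A1, routine stub) The graph of the Bloch–Wigner function over the upper half plane is
definable with parameters in `ℝ_an,exp` (restricted-analytic pieces of `Li₂` away from `0, 1, ∞`,
functional equations + `log`, `arctan` near the three cusps). -/
def DefinableBlochWignerGraph : Prop :=
  (univ : Set ℝ).Definable Language.realAnExp
    {v : Fin 3 → ℝ | 0 < v 1 ∧ v 2 = blochWignerDilog ⟨v 0, v 1⟩}

/-- (A1', routine stub) hence every level set `Z_n` is `ℝ_an,exp`-definable. -/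
def DefinableLevelSets : Prop :=
  ∀ (k : ℕ) (n : Fin k → ℤ), (univ : Set ℝ).Definable Language.realAnExp (levelSet k n)

/-- **Counting corollary (PROVED from tree facts + A1').** For every `k`, `n`, `ε > 0` there is `c`
with `#(Z_n ∖ Z_n^alg)(ℚ, H) ≤ c · H^ε`: the GAUSSIAN-RATIONAL solutions of height `≤ H` of
`Σ nᵢ D(zᵢ) = 0` lying on no real-algebraic arc of solutions are `O(H^ε)` — Zagier's conjecture
predicts there are none at all outside the explained locus. -/
theorem levelSet_ratPoints_sparse (hPW : PilaWilkie2006_thm_1_8)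
    (hO : VandendriesMiller1994_realAnExp_isOMinimal) (hD : DefinableLevelSets)
    (k : ℕ) (n : Fin k → ℤ) (ε : ℝ) (hε : 0 < ε) :
    ∃ c : ℝ, ∀ H : ℕ, 1 ≤ H →
      (ratPointsLE (transPart (levelSet k n)) H).Finite ∧
        ((ratPointsLE (transPart (levelSet k n)) H).ncard : ℝ) ≤ c * (H : ℝ) ^ ε :=
  pilaWilkie_realAnExp hPW hO _ (levelSet k n) (hD k n) ε hε

/-- **NoFlatArcs (k = 1 real-arc Ax–Lindemann, THEOREM-CANDIDATE, proof sketched on the card):**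
`D` is constant on no real-algebraic arc off the real line: the algebraic part of every non-zero
level curve `{D = c}` is empty. Equivalently a real algebraic curve meets `{D = c}`, `c ≠ 0`, in a
finite set. -/
def NoFlatArcs : Prop :=
  ∀ c : ℝ, c ≠ 0 → algPart {v : Fin (1 + 1) → ℝ | blochWignerDilog (toC 1 v 0) = c} = ∅

/-- The same, curve form. -/
def NoFlatArcs' : Prop :=
  ∀ c : ℝ, c ≠ 0 → ∀ P : MvPolynomial (Fin 2) ℝ, P ≠ 0 →
    {z : ℂ | MvPolynomial.eval ![z.re, z.im] P = 0 ∧ blochWignerDilog z = c}.Finite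

/-- The six "explained" correspondences for `D(z₁) = D(z₂)` on `ℍ⁺ × ℍ⁺`: the even anharmonic maps
`z, 1 − 1/z, 1/(1 − z)` and their composites with `w ↦ 1/w̄` (all preserve `ℍ⁺` and `D`). -/
def explainedPairs : Set (Fin (2 + 2) → ℝ) :=
  {v | toC 2 v 1 = toC 2 v 0} ∪ {v | toC 2 v 1 = 1 - (toC 2 v 0)⁻¹} ∪
    {v | toC 2 v 1 = (1 - toC 2 v 0)⁻¹} ∪ {v | toC 2 v 1 = (conj (toC 2 v 0))⁻¹} ∪
    {v | toC 2 v 1 = 1 - conj (toC 2 v 0)} ∪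
    {v | toC 2 v 1 = conj (toC 2 v 0) / (conj (toC 2 v 0) - 1)}

/-- **RealArcAxLindemannTwo (k = 2, THEOREM-CANDIDATE):** every real-algebraic arc inside
`{(z₁,z₂) ∈ ℍ⁺ × ℍ⁺ : D(z₁) = D(z₂)}` lies on one of the six explained correspondences — so the
Pila–Wilkie count above is a count of GENUINE exceptions to Zagier's conjecture for `n = (1,−1)`. -/
def RealArcAxLindemannTwo : Prop :=
  algPart (levelSet 2 ![1, -1]) ⊆ explainedPairs

/-- A pair is EXPLAINED when `[z₁] − [z₂]` lies in the relator group (then `D(z₁) = D(z₂)` is a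
consequence of the five-term relation and the symmetries). -/
def IsExplained₂ (v : Fin (2 + 2) → ℝ) : Prop :=
  FreeAbelianGroup.of (toC 2 v 0) - FreeAbelianGroup.of (toC 2 v 1) ∈ AddSubgroup.closure dilogRelators

/-- Zagier's conjecture for two-term relations `D(z₁) = D(z₂)` (the instance `k = 2`, `n = (1,−1)`). -/
def ZagierTwoTerm : Prop :=
  ∀ v ∈ levelSet 2 ![1, -1], IsAlgebraic ℚ (toC 2 v 0) → IsAlgebraic ℚ (toC 2 v 1) → IsExplained₂ v

/-- The crux implies its two-term instance (PROVED). -/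
theorem zagierTwoTerm_of_crux (h : Theses.HyperbolicBloch.ZagierDilogarithmConjecture) :
    ZagierTwoTerm := by
  intro v hv h0 h1
  have hZ := (ZagierDilogarithmRelationsConjecture.iff_blochWignerDilog'.1 (crux_iff.1 h)) 2
    (fun i => toC 2 v i) ![1, -1] (by intro i; fin_cases i <;> assumption)
    (by
      intro i
      have := hv.1 i
      fin_cases i <;> simpa [toC] using (by simpa using this))
    (by simpa [Fin.sum_univ_two] using hv.2)
  simpa [IsExplained₂, Fin.sum_univ_two, sub_eq_add_neg] using hZ

/-- **The o-minimal dichotomy (PROVED, pure logic):** the two-term conjecture splits into its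
ALGEBRAIC-PART clause (points on real-algebraic arcs of solutions) and its TRANSCENDENTAL-PART
clause (isolated solutions), `X = X^alg ∪ X^trans`. -/
theorem zagierTwoTerm_iff_parts :
    ZagierTwoTerm ↔
      (∀ v ∈ algPart (levelSet 2 ![1, -1]),
          IsAlgebraic ℚ (toC 2 v 0) → IsAlgebraic ℚ (toC 2 v 1) → IsExplained₂ v) ∧
      (∀ v ∈ transPart (levelSet 2 ![1, -1]),
          IsAlgebraic ℚ (toC 2 v 0) → IsAlgebraic ℚ (toC 2 v 1) → IsExplained₂ v) := by
  constructor
  · intro h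
    exact ⟨fun v hv => h v (algPart_subset _ hv), fun v hv => h v (transPart_subset _ hv)⟩
  · rintro ⟨hA, hT⟩ v hv h0 h1
    by_cases hm : v ∈ algPart (levelSet 2 ![1, -1])
    · exact hA v hm h0 h1
    · exact hT v ((mem_transPart_iff).2 ⟨hv, hm⟩) h0 h1

/-- (M stub) points of the six correspondences are explained: `[z] − [γ z] ∈ ⟨dilogRelators⟩` for
the even anharmonic maps and their `1/w̄`-composites (inversion/reflection relators in `P(ℚ̄)`,
tree `PreBloch.sym_inv`, `sym_one_sub` over an algebraically closed field). -/
def ExplainedPairsExplained : Prop :=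
  ∀ v ∈ explainedPairs, v ∈ levelSet 2 ![1, -1] →
    IsAlgebraic ℚ (toC 2 v 0) → IsAlgebraic ℚ (toC 2 v 1) → IsExplained₂ v

/-- Real-arc Ax–Lindemann discharges the algebraic-part clause (PROVED from the two Props). -/
theorem algPart_clause_of (hAL : RealArcAxLindemannTwo) (hE : ExplainedPairsExplained) :
    ∀ v ∈ algPart (levelSet 2 ![1, -1]),
      IsAlgebraic ℚ (toC 2 v 0) → IsAlgebraic ℚ (toC 2 v 1) → IsExplained₂ v :=
  fun v hv h0 h1 => hE v (hAL hv) (algPart_subset _ hv) h0 h1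

/-- **The open core, isolated by o-minimality (k = 2):** ISOLATED algebraic solutions of
`D(z₁) = D(z₂)` (points of the transcendental part) are explained. Zagier's conjecture predicts the
hypothesis is vacuous (no such points); `levelSet_ratPoints_sparse` says they are `O(H^ε)`-sparse
among Gaussian rationals; nothing else is known (Neumann 1998 §1). -/
def TransPartExplainedTwo : Prop :=
  ∀ v ∈ transPart (levelSet 2 ![1, -1]),
    IsAlgebraic ℚ (toC 2 v 0) → IsAlgebraic ℚ (toC 2 v 1) → IsExplained₂ v

/-- Assembly of the k = 2 line (PROVED modulo the three Props). -/
theorem zagierTwoTerm_of (hAL : RealArcAxLindemannTwo) (hE : ExplainedPairsExplained)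
    (hT : TransPartExplainedTwo) : ZagierTwoTerm :=
  zagierTwoTerm_iff_parts.2 ⟨algPart_clause_of hAL hE, hT⟩

/-! ## §B Kummer–Clausen linearisation: transfer to the unit circle -/

/-- conj of an algebraic number is algebraic. [folklore] -/
theorem isAlgebraic_conj {x : ℂ} (hx : IsAlgebraic ℚ x) : IsAlgebraic ℚ (conj x) := by
  simpa using hx.algHom (starRingEnd ℂ).toRatAlgHom

/-- **Kummer's relation inside the relator group (PROVED).** For algebraic `z ∉ ℝ`,
`2[z] − [z/z̄] − [(1 − z⁻¹)/(1 − z̄⁻¹)] − [(1 − z̄)/(1 − z)]` lies in the subgroup generated by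
`dilogRelators`: it is the five-term relator at `(x, y) = (z, z̄)` plus `[z] + [z̄]` minus
`[u₁] + [ū₁]` minus `[u₃] + [ū₃]` (`u₁ = z/z̄`, `u₃ = (1 − z̄)/(1 − z)`, so `ū₁ = z̄/z`,
`ū₃ = (1 − z)/(1 − z̄)`). Its `D`-shadow is Kummer's `2D(z) = D(z/z̄) + D((1−1/z)/(1−1/z̄)) +
D((1/(1−z))/(1/(1−z̄)))` (Zagier 2007, Ch. I §3): the three arguments have modulus `1`. -/
theorem kummer_mem_closure {z : ℂ} (hz : IsAlgebraic ℚ z) (him : z.im ≠ 0) :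
    2 • FreeAbelianGroup.of z - FreeAbelianGroup.of (z / conj z) -
        FreeAbelianGroup.of ((1 - z⁻¹) / (1 - (conj z)⁻¹)) -
        FreeAbelianGroup.of ((1 - conj z) / (1 - z)) ∈ AddSubgroup.closure dilogRelators := by
  have hz0 : z ≠ 0 := fun h => him (by simp [h])
  have hz1 : z ≠ 1 := fun h => him (by simp [h])
  have hzb0 : conj z ≠ 0 := by simpa using (map_ne_zero (starRingEnd ℂ)).2 hz0
  have hzb1 : conj z ≠ 1 := by
    intro h; apply hz1
    have := congrArg conj h
    simpa using this
  have hzz : z ≠ conj z := by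
    intro h
    have := congrArg Complex.im h
    simp only [Complex.conj_im] at this
    exact him (by linarith)
  have hzb : IsAlgebraic ℚ (conj z) := isAlgebraic_conj hz
  -- the four relators
  have hFT := AddSubgroup.subset_closure (fiveTerm_mem_dilogRelators hz hzb hz0 hz1 hzb0 hzb1 hzz)
  have hS0 := AddSubgroup.subset_closure (of_add_of_conj_mem_dilogRelators hz)
  have hu1 : IsAlgebraic ℚ (z / conj z) := hz.mul hzb.inv
  have hu3 : IsAlgebraic ℚ ((1 - conj z) / (1 - z)) :=
    (isAlgebraic_one.sub hzb).mul (isAlgebraic_one.sub hz).inv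
  have hS1 := AddSubgroup.subset_closure (of_add_of_conj_mem_dilogRelators hu1)
  have hS3 := AddSubgroup.subset_closure (of_add_of_conj_mem_dilogRelators hu3)
  -- conj of the unimodular arguments
  have e1 : (starRingEnd ℂ) (z / conj z) = conj z / z := by
    rw [map_div₀, Complex.conj_conj]
  have e3 : (starRingEnd ℂ) ((1 - conj z) / (1 - z)) = (1 - z) / (1 - conj z) := by
    rw [map_div₀, map_sub, map_sub, map_one, Complex.conj_conj]
  rw [e1] at hS1
  rw [e3] at hS3
  have key : 2 • FreeAbelianGroup.of z - FreeAbelianGroup.of (z / conj z) -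
        FreeAbelianGroup.of ((1 - z⁻¹) / (1 - (conj z)⁻¹)) -
        FreeAbelianGroup.of ((1 - conj z) / (1 - z)) =
      (FreeAbelianGroup.of z - FreeAbelianGroup.of (conj z) + FreeAbelianGroup.of (conj z / z) -
          FreeAbelianGroup.of ((1 - z⁻¹) / (1 - (conj z)⁻¹)) +
          FreeAbelianGroup.of ((1 - z) / (1 - conj z))) +
        (FreeAbelianGroup.of z + FreeAbelianGroup.of (conj z)) -
        (FreeAbelianGroup.of (z / conj z) + FreeAbelianGroup.of (conj z / z)) -
        (FreeAbelianGroup.of ((1 - conj z) / (1 - z)) + FreeAbelianGroup.of ((1 - z) / (1 - conj z))) := by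
    abel
  rw [key]
  exact AddSubgroup.sub_mem _ (AddSubgroup.sub_mem _ (AddSubgroup.add_mem _ hFT hS0) hS1) hS3

/-- `D((1 − w)⁻¹) = D(w)` (rotation of order three about `e^{iπ/3}`). [folklore] -/
theorem bw_inv_one_sub (w : ℂ) : blochWignerDilog (1 - w)⁻¹ = blochWignerDilog w := by
  rw [blochWignerDilog_inv, blochWignerDilog_one_sub, neg_neg]

/-- **Neumann's form of the five-term relation for `D` (PROVED from the tree's Zagier form):**
`D(x) − D(y) + D(y/x) − D((1−x⁻¹)/(1−y⁻¹)) + D((1−x)/(1−y)) = 0` for `x, y ∉ {0,1}`, `x ≠ y` — it is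
minus `blochWignerDilog_five_term` at `(a, b) = (y, x⁻¹)` rewritten with `D(w⁻¹) = −D(w)`,
`D(1 − w) = −D(w)`, `D((1 − w)⁻¹) = D(w)`. This is the SOUNDNESS of the five-term relators of the crux.
[cite: Neumann1998, §2 eq. (2.3)] -/
theorem five_term_neumann {x y : ℂ} (hx0 : x ≠ 0) (hx1 : x ≠ 1) (hy0 : y ≠ 0) (hy1 : y ≠ 1)
    (hxy : x ≠ y) :
    blochWignerDilog x - blochWignerDilog y + blochWignerDilog (y / x) -
        blochWignerDilog ((1 - x⁻¹) / (1 - y⁻¹)) + blochWignerDilog ((1 - x) / (1 - y)) = 0 := by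
  have hb0 : x⁻¹ ≠ 0 := inv_ne_zero hx0
  have hb1 : x⁻¹ ≠ 1 := by
    intro h; apply hx1; simpa using congrArg (·⁻¹) h
  have hab : y * x⁻¹ ≠ 1 := by
    intro h; apply hxy
    have : y = x := by
      field_simp at h
      linear_combination h
    exact this.symm
  have h := blochWignerDilog_five_term hy0 hy1 hb0 hb1 hab
  have hx1' : (1 : ℂ) - x ≠ 0 := sub_ne_zero.2 (Ne.symm hx1)
  have hy1' : (1 : ℂ) - y ≠ 0 := sub_ne_zero.2 (Ne.symm hy1)
  have hxy' : x - y ≠ 0 := sub_ne_zero.2 hxy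
  have hyx' : y - x ≠ 0 := sub_ne_zero.2 (Ne.symm hxy)
  have e1 : (1 - y) / (1 - y * x⁻¹) = (1 - (1 - x⁻¹) / (1 - y⁻¹))⁻¹ := by
    rw [eq_comm, inv_eq_iff_eq_inv, inv_div]
    field_simp
    ring
  have e2 : (1 - x⁻¹) / (1 - y * x⁻¹) = (1 - ((1 - x) / (1 - y))⁻¹)⁻¹ := by
    rw [eq_comm, inv_eq_iff_eq_inv, inv_div, inv_div]
    field_simp
    ring
  have e3 : 1 - y * x⁻¹ = 1 - y / x := by rw [div_eq_mul_inv]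
  rw [e1, e2, e3, bw_inv_one_sub, bw_inv_one_sub, blochWignerDilog_inv, blochWignerDilog_inv,
    blochWignerDilog_one_sub] at h
  linear_combination -h

/-- The value homomorphism `ℤ[ℂ] → ℝ`, `[w] ↦ D(w)`. -/
def dValue : FreeAbelianGroup ℂ →+ ℝ := FreeAbelianGroup.lift blochWignerDilog

@[simp] theorem dValue_of (w : ℂ) : dValue (FreeAbelianGroup.of w) = blochWignerDilog w :=
  FreeAbelianGroup.lift_apply_of _ _

/-- **Soundness of the relator group (PROVED):** every element of `⟨dilogRelators⟩` has `D`-value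
`0` — five-term relators by `five_term_neumann`, `[w] + [w̄]` by `blochWignerDilog_conj'`, real `[w]`
by `blochWignerDilog_of_im_eq_zero`. (So the crux's conclusion implies its hypothesis: the
conjecture is an `iff` up to this lemma.) -/
theorem dValue_eq_zero_of_mem_closure {c : FreeAbelianGroup ℂ}
    (hc : c ∈ AddSubgroup.closure dilogRelators) : dValue c = 0 := by
  refine (AddSubgroup.closure_le (K := dValue.ker)).2 ?_ hc
  rintro r ((⟨x, y, -, -, hx0, hx1, hy0, hy1, hxy, rfl⟩ | ⟨w, -, rfl⟩) | ⟨w, hw, rfl⟩)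
  · simp only [AddMonoidHom.mem_ker, map_add, map_sub, dValue_of, SetLike.mem_coe]
    exact five_term_neumann hx0 hx1 hy0 hy1 hxy
  · simp only [AddMonoidHom.mem_ker, map_add, dValue_of, SetLike.mem_coe, blochWignerDilog_conj',
      add_neg_cancel]
  · simp only [AddMonoidHom.mem_ker, dValue_of, SetLike.mem_coe, blochWignerDilog_of_im_eq_zero hw]

/-- **Kummer's identity for values (PROVED as the `D`-shadow of `kummer_mem_closure`):**
`2D(z) = D(z/z̄) + D((1−z⁻¹)/(1−z̄⁻¹)) + D((1−z̄)/(1−z))` for algebraic `z ∉ ℝ` (the algebraicity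
hypothesis is inherited from the relator group; the identity holds for all `z ∉ ℝ`).
[cite: Zagier2007Dilogarithm, Ch. I §3] -/
theorem two_mul_blochWignerDilog {z : ℂ} (hz : IsAlgebraic ℚ z) (him : z.im ≠ 0) :
    2 * blochWignerDilog z = blochWignerDilog (z / conj z) +
      blochWignerDilog ((1 - z⁻¹) / (1 - (conj z)⁻¹)) + blochWignerDilog ((1 - conj z) / (1 - z)) := by
  have h := dValue_eq_zero_of_mem_closure (kummer_mem_closure hz him)
  rw [map_sub, map_sub, map_sub, map_nsmul, dValue_of, dValue_of, dValue_of, dValue_of,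
    nsmul_eq_mul, Nat.cast_ofNat] at h
  linear_combination h

/-- Converse sanity (PROVED): an explained combination has vanishing `D`-sum. -/
theorem sum_eq_zero_of_explained {k : ℕ} (z : Fin k → ℂ) (n : Fin k → ℤ)
    (h : (∑ i, n i • FreeAbelianGroup.of (z i)) ∈ AddSubgroup.closure dilogRelators) :
    ∑ i, (n i : ℝ) * blochWignerDilog (z i) = 0 := by
  have := dValue_eq_zero_of_mem_closure h
  simp only [map_sum, map_zsmul, dValue_of] at this
  simpa only [zsmul_eq_mul] using this

/-- **C⁺ = the Clausen / unit-circle form of Zagier's conjecture**: the same statement restricted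
to algebraic points of MODULUS ONE in the upper half plane, where `D(e^{iθ}) = Cl₂(θ) = Im Li₂`
has no `log·arg` term, so that every putative relation is a `ℤ`-LINEAR form in dilogarithm values
`Σ mⱼ (Li₂(uⱼ) − Li₂(1/uⱼ)) = 0` (Milnor's Lobachevsky/Kubert form at roots of unity). -/
def ClausenForm : Prop :=
  ∀ (k : ℕ) (u : Fin k → ℂ) (m : Fin k → ℤ), (∀ i, IsAlgebraic ℚ (u i)) → (∀ i, 0 < (u i).im) →
    (∀ i, ‖u i‖ = 1) → ∑ i, (m i : ℝ) * blochWignerDilog (u i) = 0 →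
      (∑ i, m i • FreeAbelianGroup.of (u i)) ∈ AddSubgroup.closure dilogRelators

/-- The trivial direction (PROVED): Zagier's conjecture implies its Clausen form. -/
theorem clausenForm_of (h : ZagierDilogarithmRelationsConjecture) : ClausenForm := by
  intro k u m hu him _ hsum
  exact (ZagierDilogarithmRelationsConjecture.iff_blochWignerDilog'.1 h) k u m hu him hsum

/-- **2-saturation of the relator group** (THEOREM-CANDIDATE, M: from the tree's PROVED
`PreBloch.two_nsmul_injective` + `PreBloch.nsmul_surjective` over the algebraically closed field of
algebraic numbers, and `image(sym ∪ real) = P(ℚ̄)⁺`): `2x ∈ ⟨dilogRelators⟩ → x ∈ ⟨dilogRelators⟩`. -/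
def TwoSaturation : Prop :=
  ∀ x : FreeAbelianGroup ℂ, 2 • x ∈ AddSubgroup.closure dilogRelators →
    x ∈ AddSubgroup.closure dilogRelators

/-- **The transfer (stub, M):** Clausen form + 2-saturation ⇒ Zagier's conjecture, by
`kummer_mem_closure` (each `2[zᵢ]` replaced by three unimodular symbols), Kummer's identity for `D`
(from the tree's PROVED `blochWignerDilog_five_term` + `blochWignerDilog_conj'`), normalisation of
the unimodular arguments to `ℍ⁺` (`[u] = ([u]+[ū]) − [ū]`, `[±1]` real), and division by `2`. -/
def ZagierOfClausenForm : Prop :=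
  TwoSaturation → ClausenForm → ZagierDilogarithmRelationsConjecture

/-- How the pieces would conclude the crux BY NAME (term, proved modulo the two Props). -/
theorem crux_of_clausenForm (hT : ZagierOfClausenForm) (h2 : TwoSaturation) (hC : ClausenForm) :
    Theses.HyperbolicBloch.ZagierDilogarithmConjecture :=
  crux_iff.2 (hT h2 hC)

end Summit.KontsevichZagierPeriods.KontsevichZagierPeriods.Cruxes.ZagierDilogarithmConjecture.Ideator1

end
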